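import Summits.Schanuel.Schanuel.Theses.RootDecomp1E

/-!
# RootDecomp1E — definitions for the ANCHOR calculus of route RootDecomp1E (lens-2 «DarkAnchor» / «AxisAnchor» / «AnchorTower»)

Vocabulary shared by the Theorems files `RootDecomp1EAnchorToolkit`, `RootDecomp1EAnchorTowers`, `RootDecomp1EOffAxisClosure`
(port of the cone of `offAxisClosure_holds` in `HOME/decomp-schanuel-lens-2/g6/AnchorTower.lean`, critic CLEARED
2026-08-30T06:41:43Z / 07:30:30Z, by the census seat in its prover role).  Every route item of RootDecomp1E (stmt-Schanuel-27517,
27518, 28355, 28356, 30099, 30100, 30101) INLINES these notions; the definitions below are their verbatim sub-terms, so that the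
items unfold to the structured statements by `Iff.rfl` (`offAxisClosure_iff` below).

* `closedFormField` — 𝕃, the least subfield of ℂ closed under `exp`, under all logarithms and relatively algebraically closed
  (Chow 1999 §3, Lin 1983, Ritt 1948: the closed-form / Liouvillian numbers) — the exact `sInf` term of the items;
* `SpanMinimal`, `Saturated`, `Dark`, `Anchored`, `AlgFree`, `LogFree` — the hypotheses of the anchored-dark-atom items;
* `OffAxisAnchoredDarkAtomSchanuel` — the conclusion of the support item `OffAxisClosure` (stmt-Schanuel-30101);
* `IsTower` — REDUCED TOWERS (Chow's «towers»): tuples built by prepending `x` with `x` or `e^x` algebraic over the field of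
  the numbers already present; `InTower x` — `x` is algebraic over the field of some ℚ-independent reduced tower;
* `ClosedFormSchanuel` (Schanuel for closed-form tuples) and `GLin` (generalised Lin theorem: a closed-form tuple on the
  boundary of Schanuel's inequality spans a non-zero algebraic number or logarithm of one).
No theorems beyond `Iff.rfl` unfolding certificates; no instances, no notation.
-/

set_option linter.dupNamespace false

noncomputable section

namespace Summit.Schanuel.Schanuel.Theorems.RootDecomp1EAnchor

open Complex IntermediateField
open Summit.Schanuel.Schanuel.Theses.RootDecomp1E (DefectOneSchanuel ClosedFormAtomSchanuel OffAxisClosure)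

/-- 𝕃 — the smallest subfield of ℂ closed under `exp`, under all logarithms, and relatively algebraically closed
(Chow 1999 §3 / Lin 1983 / Ritt 1948: the closed-form numbers).  The route items INLINE this term verbatim. -/
def closedFormField : IntermediateField ℚ ℂ :=
  sInf {K : IntermediateField ℚ ℂ | (∀ w ∈ K, Complex.exp w ∈ K) ∧
    (∀ w : ℂ, Complex.exp w ∈ K → w ∈ K) ∧ ∀ w : ℂ, IsAlgebraic K w → w ∈ K}

/-- SPAN-MINIMALITY of `z`: every strictly shorter ℚ-independent tuple inside `span_ℚ z` satisfies Schanuel. -/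
def SpanMinimal (n : ℕ) (z : Fin n → ℂ) : Prop :=
  ∀ (m : ℕ) (w : Fin m → ℂ), m < n → LinearIndependent ℚ w →
    (∀ j, w j ∈ Submodule.span ℚ (Set.range z)) →
    (m : Cardinal) ≤ Algebra.trdeg ℚ ↥(IntermediateField.adjoin ℚ (Set.range w ∪ Set.range (Complex.exp ∘ w)))

/-- SATURATION of `z`: every `v` with `v, e^v` algebraic over `F_z = ℚ(z, e^z)` lies in `span_ℚ z`. -/
def Saturated (n : ℕ) (z : Fin n → ℂ) : Prop :=
  ∀ v : ℂ, IsAlgebraic ↥(IntermediateField.adjoin ℚ (Set.range z ∪ Set.range (Complex.exp ∘ z))) v →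
    IsAlgebraic ↥(IntermediateField.adjoin ℚ (Set.range z ∪ Set.range (Complex.exp ∘ z))) (Complex.exp v) →
    v ∈ Submodule.span ℚ (Set.range z)

/-- DARK: some coordinate lies outside 𝕃. -/
def Dark (n : ℕ) (z : Fin n → ℂ) : Prop := ∃ i, z i ∉ closedFormField

/-- ANCHORED: `span_ℚ z` contains a non-zero closed-form number (the ANCHOR `span_ℚ z ∩ 𝕃` is non-zero). -/
def Anchored (n : ℕ) (z : Fin n → ℂ) : Prop :=
  ∃ x ∈ Submodule.span ℚ (Set.range z), x ≠ 0 ∧ x ∈ closedFormField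

/-- `span_ℚ z ∩ ℚ̄ = 0`. -/
def AlgFree (n : ℕ) (z : Fin n → ℂ) : Prop :=
  ∀ x ∈ Submodule.span ℚ (Set.range z), IsAlgebraic ℚ x → x = 0

/-- `span_ℚ z ∩ 𝓛 = 0` (`𝓛 = exp⁻¹ ℚ̄`, the ℚ-space of logarithms of algebraic numbers). -/
def LogFree (n : ℕ) (z : Fin n → ℂ) : Prop :=
  ∀ x ∈ Submodule.span ℚ (Set.range z), IsAlgebraic ℚ (Complex.exp x) → x = 0

/-- OADK — OFF-AXIS ANCHORED DARK ATOM SCHANUEL: the conclusion of the support item `OffAxisClosure` (stmt-Schanuel-30101),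
verbatim: no ℚ-independent DARK, ANCHORED, span-minimal, saturated failure of Schanuel whose span contains neither a non-zero
algebraic number nor a non-zero logarithm of an algebraic number. -/
def OffAxisAnchoredDarkAtomSchanuel : Prop :=
  ∀ (n : ℕ) (z : Fin n → ℂ), LinearIndependent ℚ z → (∃ i, z i ∉ (sInf {K : IntermediateField ℚ ℂ | (∀ w ∈ K, Complex.exp w ∈ K) ∧ (∀ w : ℂ, Complex.exp w ∈ K → w ∈ K) ∧ ∀ w : ℂ, IsAlgebraic K w → w ∈ K} : IntermediateField ℚ ℂ)) → (∃ x ∈ Submodule.span ℚ (Set.range z), x ≠ 0 ∧ x ∈ (sInf {K : IntermediateField ℚ ℂ | (∀ w ∈ K, Complex.exp w ∈ K) ∧ (∀ w : ℂ, Complex.exp w ∈ K → w ∈ K) ∧ ∀ w : ℂ, IsAlgebraic K w → w ∈ K} : IntermediateField ℚ ℂ)) → (∀ x ∈ Submodule.span ℚ (Set.range z), IsAlgebraic ℚ x → x = 0) → (∀ x ∈ Submodule.span ℚ (Set.range z), IsAlgebraic ℚ (Complex.exp x) → x = 0) → (∀ (m : ℕ) (w : Fin m → ℂ), m < n → LinearIndependent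 ℚ w → (∀ j, w j ∈ Submodule.span ℚ (Set.range z)) → (m : Cardinal) ≤ Algebra.trdeg ℚ ↥(IntermediateField.adjoin ℚ (Set.range w ∪ Set.range (Complex.exp ∘ w)))) → (∀ v : ℂ, IsAlgebraic ↥(IntermediateField.adjoin ℚ (Set.range z ∪ Set.range (Complex.exp ∘ z))) v → IsAlgebraic ↥(IntermediateField.adjoin ℚ (Set.range z ∪ Set.range (Complex.exp ∘ z))) (Complex.exp v) → v ∈ Submodule.span ℚ (Set.range z)) → (n : Cardinal) ≤ Algebra.trdeg ℚ ↥(IntermediateField.adjoin ℚ (Set.range z ∪ Set.range (Complex.exp ∘ z)))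

/-- The support item `OffAxisClosure` (stmt-Schanuel-30101) unfolds to `S⁻ → CF → OADK`. -/
theorem offAxisClosure_iff :
    OffAxisClosure ↔ (DefectOneSchanuel → ClosedFormAtomSchanuel → OffAxisAnchoredDarkAtomSchanuel) := Iff.rfl

/-- OADK in the structured vocabulary. -/
theorem offAxisAnchoredDark_iff : OffAxisAnchoredDarkAtomSchanuel ↔
    ∀ (n : ℕ) (z : Fin n → ℂ), LinearIndependent ℚ z → Dark n z → Anchored n z → AlgFree n z →
      LogFree n z → SpanMinimal n z → Saturated n z →
      (n : Cardinal) ≤ Algebra.trdeg ℚ ↥(adjoin ℚ (Set.range z ∪ Set.range (cexp ∘ z))) := Iff.rfl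

/-- The crux `ClosedFormAtomSchanuel` (stmt-Schanuel-27517) in the structured vocabulary. -/
theorem closedFormAtom_iff : ClosedFormAtomSchanuel ↔
    ∀ (n : ℕ) (z : Fin n → ℂ), LinearIndependent ℚ z → (∀ i, z i ∈ closedFormField) →
      SpanMinimal n z → Saturated n z →
      (n : Cardinal) ≤ Algebra.trdeg ℚ ↥(adjoin ℚ (Set.range z ∪ Set.range (cexp ∘ z))) := Iff.rfl

/-- REDUCED TOWER (Chow 1999 §3 «towers», Lin 1983, Ritt 1948): the tuple `t : Fin τ → ℂ` is obtained by successively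
PREPENDING a number `x` such that `x` OR `e^x` is algebraic over the field `ℚ(t, e^t)` generated by the numbers already present. -/
inductive IsTower : ∀ τ : ℕ, (Fin τ → ℂ) → Prop
  | zero (t : Fin 0 → ℂ) : IsTower 0 t
  | cons {τ : ℕ} (t : Fin τ → ℂ) (x : ℂ) :
      IsTower τ t →
      (IsAlgebraic ↥(adjoin ℚ (Set.range t ∪ Set.range (cexp ∘ t))) x ∨
        IsAlgebraic ↥(adjoin ℚ (Set.range t ∪ Set.range (cexp ∘ t))) (cexp x)) →
      IsTower (τ + 1) (Fin.cons x t : Fin (τ + 1) → ℂ)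

/-- `x` is algebraic over the field of some ℚ-independent reduced tower. -/
def InTower (x : ℂ) : Prop :=
  ∃ (τ : ℕ) (t : Fin τ → ℂ), IsTower τ t ∧ LinearIndependent ℚ t ∧
    IsAlgebraic ↥(adjoin ℚ (Set.range t ∪ Set.range (cexp ∘ t))) x

/-- 𝕋 — the TOWER FIELD: the subfield of ℂ generated by the numbers algebraic over some ℚ-independent reduced tower (it consists
exactly of those numbers — `mem_towerField_iff` in `RootDecomp1EAnchorTowers` — and contains 𝕃). -/
def towerField : IntermediateField ℚ ℂ := IntermediateField.adjoin ℚ {x | InTower x}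

/-- CLOSED-FORM SCHANUEL `CFS`: Schanuel's conjecture for ℚ-independent tuples of closed-form numbers. -/
def ClosedFormSchanuel : Prop :=
  ∀ (n : ℕ) (z : Fin n → ℂ), LinearIndependent ℚ z → (∀ i, z i ∈ closedFormField) →
    (n : Cardinal) ≤ Algebra.trdeg ℚ ↥(adjoin ℚ (Set.range z ∪ Set.range (cexp ∘ z)))

/-- GENERALISED LIN `GLin`: a ℚ-independent closed-form tuple ON THE BOUNDARY of Schanuel's inequality
(`trdeg ℚ(ℓ, e^ℓ) ≤ a`) spans a non-zero algebraic number or a non-zero logarithm of an algebraic number.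
(Lin 1983 is the case `a = 1`; see Chow 1999 §3.) -/
def GLin : Prop :=
  ∀ (a : ℕ) (ℓ : Fin a → ℂ), 0 < a → LinearIndependent ℚ ℓ → (∀ j, ℓ j ∈ closedFormField) →
    Algebra.trdeg ℚ ↥(adjoin ℚ (Set.range ℓ ∪ Set.range (cexp ∘ ℓ))) ≤ (a : Cardinal) →
    ∃ x ∈ Submodule.span ℚ (Set.range ℓ), x ≠ 0 ∧ (IsAlgebraic ℚ x ∨ IsAlgebraic ℚ (cexp x))


end Summit.Schanuel.Schanuel.Theorems.RootDecomp1EAnchor
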